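import Mathlib
import Summits.Ventures.PercRepro2.PointSplitPrincipal

/-!
# The point-split candidates without avoidance when the `s`–`v` connection is a single path
(blind cell PercRepro2, night-3 g23, 2026-08-28; `proofs/NIGHT3-CERT.md` §32.17)

If the connection event `{s ↔ v}` is a principal up-set `A_S` (the `s`–`v` path is unique, e.g. on a
tree: `S` = its edge set), the abstract theorems of `PointSplitPrincipal.lean` apply to the cluster
functionals `F(C_s), G(C_s)` (monotone in `ω`) and give (PS1) and (PS) with `X = Y = ∅`:
`mixedForm_one_nonneg_of_connEvent_eq_prinEvent`, `mixedForm_split_nonneg_of_connEvent_eq_prinEvent`.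
Own work; standard axioms.
-/

namespace Summit.Ventures.PercRepro2

open UnionCluster

namespace CovForm

namespace PointSplit

variable {V : Type*} {E : Type*} [Fintype E] [DecidableEq E]
  {R : Type*} [Field R] [LinearOrder R] [IsStrictOrderedRing R]

omit [Fintype E] [DecidableEq E] [LinearOrder R] [IsStrictOrderedRing R] in
/-- The complementary indicator as `1 − 1_A`. -/
lemma indicator_compl_eq_one_sub (A : Set (Config E)) (ω : Config E) :
    Aᶜ.indicator (1 : Config E → R) ω = 1 - A.indicator 1 ω := by
  by_cases h : ω ∈ A
  · rw [Set.indicator_of_mem h, Set.indicator_of_notMem (show ω ∉ Aᶜ from fun h' => h' h)]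
    simp
  · rw [Set.indicator_of_notMem h, Set.indicator_of_mem (show ω ∈ Aᶜ from h)]
    simp

/-- **(PS1) without avoidance when `{s ↔ v}` is principal**. -/
theorem mixedForm_one_nonneg_of_connEvent_eq_prinEvent [DecidableEq V] (p : E → R) (hp : IsProbVec p)
    (ends : E → Sym2 V) (s v : V) {S : Finset E} (hA : connEvent ends s v = prinEvent S)
    {F G : Set V → R} (hF : Monotone F) (hG : Monotone G) :
    0 ≤ mixedFormW p ends s ∅ ∅ F G ((connEvent ends s v).indicator 1) (fun _ => 1) := by
  have hfm : Monotone (fun ω : Config E => F (cluster ends ω s)) :=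
    fun ω ω' h => hF (cluster_mono h s)
  have hgm : Monotone (fun ω : Config E => G (cluster ends ω s)) :=
    fun ω ω' h => hG (cluster_mono h s)
  have key := pointSplitOne_principal hp S hfm hgm
  unfold mixedFormW
  simp only [Finset.inter_self, Finset.union_self]
  rw [wExpect_empty, wExpect_empty, wExpect_empty, wExpect_empty, wExpect_empty, wExpect_empty,
    wExpect_empty, wExpect_empty, hA]
  simp only [mul_one, expect_const]
  have e1 : (fun ω => (fun _ : Set V => (1 : R)) (cluster ends ω s) * (prinEvent S).indicator 1 ω) =
      fun ω => (prinEvent S).indicator 1 ω := by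
    funext ω; simp
  rw [e1]
  linarith [key]

/-- **(PS) without avoidance when `{s ↔ v}` is principal**. -/
theorem mixedForm_split_nonneg_of_connEvent_eq_prinEvent [DecidableEq V] (p : E → R) (hp : IsProbVec p)
    (ends : E → Sym2 V) (s v : V) {S : Finset E} (hA : connEvent ends s v = prinEvent S)
    {F G : Set V → R} (hF : Monotone F) (hG : Monotone G) :
    0 ≤ mixedFormW p ends s ∅ ∅ F G ((connEvent ends s v).indicator 1)
      (((connEvent ends s v)ᶜ).indicator 1) := by
  have hfm : Monotone (fun ω : Config E => F (cluster ends ω s)) :=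
    fun ω ω' h => hF (cluster_mono h s)
  have hgm : Monotone (fun ω : Config E => G (cluster ends ω s)) :=
    fun ω ω' h => hG (cluster_mono h s)
  have key := pointSplit_principal hp S hfm hgm
  unfold mixedFormW
  simp only [Finset.inter_self, Finset.union_self]
  rw [wExpect_empty, wExpect_empty, wExpect_empty, wExpect_empty, wExpect_empty, wExpect_empty,
    wExpect_empty, wExpect_empty, hA]
  simp only [indicator_compl_eq_one_sub]
  have e1 : (fun ω => (fun _ : Set V => (1 : R)) (cluster ends ω s) * (prinEvent S).indicator 1 ω) =
      fun ω => (prinEvent S).indicator 1 ω := by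
    funext ω; simp
  have e2 : (fun ω => (fun _ : Set V => (1 : R)) (cluster ends ω s) *
      (1 - (prinEvent S).indicator 1 ω)) = fun ω => 1 - (prinEvent S).indicator 1 ω := by
    funext ω; simp
  rw [e1, e2]
  linarith [key]

end PointSplit

end CovForm

end Summit.Ventures.PercRepro2
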